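import Summits.QuantumFields.BalabanUV.Beta.CombChartJointEnd
import Summits.QuantumFields.BalabanUV.Beta.CombOneShotJetsTabs
import Summits.QuantumFields.BalabanUV.Beta.FP.PerfectKernelSymm

/-!
# `BalabanUV.Gaps.D1RecordIndexSymmetry` — cell pub-balaban-gaps, row (D1), seat g1-p1: THE PRINTED INDEX SYMMETRY (5.8) `Π_{μν}(z) = Π_{νμ}(−z)` IS A THEOREM FOR THE
# b2b WALL's CHART-(III′) LITERAL `JsB12CombShSym hLc N tabs cΛ cB` OVER EVERY TABLE RECORD `tabs : SymTables 3 Lc` — in particular for the LITERAL OF RECORD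
# `JsB12CombShSym hLc N (symTablesAn1S2 3 Lc (2∕Lc⁴)) (2∕Lc⁴) (−Lc¹²∕4)` of `HOME/BALABAN-GAPS.md` row (D1): every step kernel satisfies `TbalOf … j a b t = TbalOf … j b a (−t)`,
# every (1.22) coefficient is channel-symmetric, and the binder `D1Drift Lc (JsB12CombShSym …) N μ ν`, the one-shot composite family `TshotOf Lc (JcOfTabs …) m` and the
# EXIT-A predicate `D1Rep Lc (JcOf …) N μ ν a SL k` do not see the order of the channel pair

HONEST FRAMING (cell rule, page 1 of everything): [folklore] kernel algebra BY NAME — road FP's generic transposition law `FP.PerfectKernelSymm.hessKer_swap` (b2b-balaban-beta-d1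
leaf-02 gen 4) at the owner an2's kernel identity `CombChartJointEnd.TbalOf_JsB12CombShSym` (`TbalOf Lc (JsB12CombShSym …) j = hessKer G′_j (vertexOfK G′_j Lc (JsB12CombSh⁰ j).S) (JsB12CombSh⁰ j).W`,
`G′_j = GcombSh Lc j`), fed with an2's `decays_GcombSh` ∕ `shiftK_GcombSh` ∕ `JsB12CombSh0_S_translate` ∕ `JsB12CombSh0_W_translate` (P3 `CombChartStepJets`), an2's
`BalabanStepJetsSucc.vertexOfK_translate_block`, the b2b D1 swarm's `SpineRooted.WrecOf_swap` (file `Beta/RecursiveWSlot`), an4's `vertexFamily_vertexOfK'`, and the β sub-cell's `PolarizationSign.secondMoment_comm`.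
NOTHING of Bałaban's asserted beyond print: (5.8) p. 293 of [Balaban1987RG1] is PRINTED for Bałaban's `Π`; what is proved is that the b2b cell's OWN typed literal satisfies the typed predicate
`PolarizationSign.IndexSymmetric` — a statement about the cell's object, not about Bałaban's kernel; [Balaban1987RG1] Thm 2 UNPROVED IN PRINT; the literal is the b2b row owner's
(beta-an2) CANDIDATE of record, asserting nothing; NO coefficient computed or signed; (D1) NOT discharged; 0∕4 row-D1 binders (the wall's END `d1Drift_of_D1Tel_D1Rep` displays `hW` (5.9)
and `hR` (5.7), NOT (5.8) — this file discharges NO binder of it); NOT `BetaPertH`, NOT continuum, NOT Clay.  HONEST DEPENDENCY (b2b cell, verbatim): «continuum YM on T⁴ ⇐ BetaPertH ∧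
nine spine estimates (0/9 proved); BetaPertH ⇐ (D1) ∧ (D4) ∧ CAP+tail; G-an2-4 gates asym, D1 and NE2/3/4.»

WHY (census row 83b of `HOME/g1/RESIDUE.md`; companion of `Gaps/D1PinnedIndexSymmetry` for the β-lead's pinned literal `JsBalAn1`).  The row (D1) of `HOME/BALABAN-GAPS.md` is typed at
the literal of record `JsB12CombShSym hLc N (symTablesAn1S2 3 Lc (2∕Lc⁴)) (2∕Lc⁴) (−Lc¹²∕4)`; its Hessian kernel is `hessKer G′_j (vertexOfK G′_j Lc S⁰_j) W⁰_j` with (i) `G′_j` decaying and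
`Lc`-block-translation invariant (THEOREMS (DG′)(TG′) of P3), (ii) `S⁰_j` a local stencil family obeying (St) (THEOREM), (iii) `W⁰_j = WrecOf …` obeying (Wt) (THEOREM) and — being an2's
swap-symmetrised carrier `W2SymOfK` — SYMMETRIC under the swap of its two coarse bonds (`WrecOf_swap`).  These are exactly the inputs of `hessKer_swap`.  So, with NO letter and NO
hypothesis beyond `Odd Lc`: (5.8) holds for every step kernel of the (III′) literal over EVERY table record (`TbalOf_JsB12CombShSym_swap`, `indexSymmetric_TbalOf_JsB12CombShSym`), every
(1.22) coefficient `β⁰_j(μ,ν)` of it is symmetric in the channel (`secondMoment_TbalOf_JsB12CombShSym_comm`), and the binder is channel-order blind (`d1Drift_JsB12CombShSym_comm`;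
at the record: `d1Drift_record_comm`).  Road FP proved the same law for ITS block-mean literal `JsRowD1` (`FP.RoadRowD1Slots.TbalOf_JsRowD1_swap`); the (III′) literal of record had none.
CONTENT (all [folklore]; no `def`, no `def … : Prop`, 0 sorry): §1 **`JsB12CombSh0_W_swap`**; §2 **`TbalOf_JsB12CombShSym_swap`**, **`indexSymmetric_TbalOf_JsB12CombShSym`**,
`indexSymmetric_flipK_TbalOf_JsB12CombShSym`; §3 **`secondMoment_TbalOf_JsB12CombShSym_comm`**, `secondMoment_TbalOf_JsB12CombShSym_comm_fun`, **`d1Drift_JsB12CombShSym_comm`**,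
**`d1Drift_record_comm`** (the literal OF RECORD, pins `(2∕Lc⁴, −Lc¹²∕4)`); §4 `ward_second_flipK_TbalOf_JsB12CombShSym_of_hW` (under the END's `hW` the SECOND identity of (5.9)
holds too, by (5.8)); §5 the ONE-SHOT COMPOSITE FAMILY of the record (the `D1Tel` ∕ `D1Rep` partner): `TshotOf_JcOfTabs_eq_TbalOf_zero` (depth `m` = level 0 of the (III′) literal at
blocking `Lc^m`), **`TshotOf_JcOfTabs_swap`**, `indexSymmetric_TshotOf_JcOfTabs`, `secondMoment_TshotOf_JcOf_comm` (an1's record `JcOf`); §6 the EXIT-A predicate: `mixedDiffFun_comm`, `cellForm_comm`,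
`stK_comm`, **`oneShotSide_comm`** (the one-shot comparison side `ScalewiseVectorSeam.oneShotSide` is channel-symmetric by inspection), **`d1Rep_JcOfTabs_comm`**, `d1Rep_JcOf_comm`
(`D1Rep Lc (JcOf …) Nc μ ν a SL k ↔ D1Rep Lc (JcOf …) Nc ν μ a SL k` — both exit predicates and the binder at the record are channel-order blind).

ABSOLUTE RULE (cell charter, verbatim): «No internally-minted statement may enter as a cited fact. Every hypothesis is either kernel-proved in this
package or a verbatim quotation of a PUBLISHED theorem with page reference. The manuscript(s) under audit are NOT citable for their own disputed
steps — they are the thing under adjudication; programme-internal (2001/route/tribunal) claims are never citable.»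

Provenance: cell pub-balaban-gaps, seat g1-p1 GEN 14 (prover-pub-balaban-gaps-g1-p1-g14-0), 2026-08-25; imports built modules only (`Beta/CombChartJointEnd`, `Beta/CombOneShotJetsTabs`,
`Beta/FP/PerfectKernelSymm`); no existing file touched; the literal and its letters are an2's ∕ P3's objects, only INSTANTIATED here.
-/

noncomputable section

open Literature.MathematicalPhysics.QuantumFieldTheory Balaban1983to89 Balaban1983to89.Beta Filter Topology
open ExpKernelCalculus (MKer Decays BiLoc VertexFamily hessKer shiftK)
open OneStepResolventKernel (Fib JetData)
open OneStepResolventKernel (TOf)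
open OneStepKernelFamily (vertexOfK vertexFamily_vertexOfK' vertexOfK_KInv TbalOf TstepOf TshotOf flipK D1Drift D1Rep)
open GhostTable (mixedDiffFun fwdDiffFun cellForm)
open SquareTable (stK stK_eq_closedForm)
open ScalewiseVectorSeam (oneShotSide)
open Summit.QuantumFields.BalabanUV.Beta.BorderedHessian (KInvStep_zero_eq)
open Summit.QuantumFields.BalabanUV.Beta.CombOneShotJetsTabs (JcOfTabs JcOfTabs_apply JcOf_eq_JcOfTabs)
open Summit.QuantumFields.BalabanUV.Beta.CombOneShotJets (JcOf)
open PolarizationSign (IndexSymmetric WardTransversal secondMoment_comm)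
open B6BondElimination (unitVec)
open BalabanStepJetsSucc (vertexOfK_translate_block)
open Summit.QuantumFields.BalabanUV.Beta.TameKernelCalculus (decays_of_le biLoc_of_le)
open Summit.QuantumFields.BalabanUV.Beta.SymmetrisedStepJets (SymTables)
open Summit.QuantumFields.BalabanUV.Beta.SpineRooted (WrecOf_swap)
open Summit.QuantumFields.BalabanUV.Beta.CombChartStepJets (GcombSh decays_GcombSh shiftK_GcombSh WcombOf WcombOf_eq JsComb0Of_W JsB12CombSh0 JsB12CombSh0_eq
  JsB12CombSh0_S_translate JsB12CombSh0_W_translate)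
open Summit.QuantumFields.BalabanUV.Beta.CombChartJointEnd (JsB12CombShSym TbalOf_JsB12CombShSym)
open Summit.QuantumFields.BalabanUV.Beta.SymSecondOrderTablesAn1 (symTablesAn1S2)
open Summit.QuantumFields.BalabanUV.Beta.FP.PerfectKernelSymm (hessKer_swap)

namespace Summit.QuantumFields.BalabanUV.Gaps.D1RecordIndexSymmetry

variable {Lc : ℕ} [NeZero Lc]

/-! ## §1 The undressed comb-chart tables are symmetric under the swap of their two coarse bonds -/

/-- [folklore] **BOND-SWAP SYMMETRY OF THE (III′) LITERAL's UNDRESSED SECOND-ORDER TABLES** (every table record, every member): `W⁰_j μ y ν y′ = W⁰_j ν y′ μ y` —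
`(JsB12CombSh⁰ … j).W = WcombOf … j = WrecOf …` (`rfl`) and the D1 swarm's `SpineRooted.WrecOf_swap` (`W2SymOfK_swap`). -/
theorem JsB12CombSh0_W_swap (hLc : Odd Lc) (N : ℕ) (tabs : SymTables 3 Lc) (cΛ cB : ℝ) (j : ℕ)
    (μ : Fin (3 + 1)) (y : Fin (3 + 1) → ℤ) (ν : Fin (3 + 1)) (y' : Fin (3 + 1) → ℤ) :
    (JsB12CombSh0 hLc N tabs cΛ cB j).W μ y ν y' = (JsB12CombSh0 hLc N tabs cΛ cB j).W ν y' μ y := by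
  rw [JsB12CombSh0_eq, JsComb0Of_W, WcombOf_eq]
  exact (WrecOf_swap _ _ _ _ _ _ _ _ j μ y ν y').symm

/-! ## §2 (5.8) for the (III′) literal over every table record -/

/-- [folklore] **THE TRANSPOSITION ∕ INDEX SYMMETRY OF EVERY STEP KERNEL OF THE (III′) LITERAL** (any table record `tabs`, any `N`, `cΛ`, `cB`, every level `j`; `Odd Lc`; no letter):
`TbalOf Lc (JsB12CombShSym …) j a b t = TbalOf Lc (JsB12CombShSym …) j b a (−t)` — an2's `TbalOf_JsB12CombShSym`, then road FP's `hessKer_swap` with (DG′) `decays_GcombSh`, (TG′) `shiftK_GcombSh`,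
`vertexFamily_vertexOfK'` + `vertexOfK_translate_block` over (St) `JsB12CombSh0_S_translate`, (Wt) `JsB12CombSh0_W_translate`, and §1, at the common rate `min δK δv`. -/
theorem TbalOf_JsB12CombShSym_swap (hLc : Odd Lc) (N : ℕ) (tabs : SymTables 3 Lc) (cΛ cB : ℝ) (j : ℕ) (a b : Fin (3 + 1)) (t : Fin (3 + 1) → ℤ) :
    TbalOf Lc (JsB12CombShSym hLc N tabs cΛ cB) j a b t = TbalOf Lc (JsB12CombShSym hLc N tabs cΛ cB) j b a (-t) := by
  rw [TbalOf_JsB12CombShSym]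
  obtain ⟨δK, C, hδK, hC, hK⟩ := decays_GcombSh (d := 3) Lc j
  obtain ⟨Cv, δv, hδv, hV⟩ := vertexFamily_vertexOfK' (N := Lc) ⟨δK, C, hδK, hC, hK⟩ (JsB12CombSh0 hLc N tabs cΛ cB j).loc
    (JsB12CombSh0 hLc N tabs cΛ cB j).δ_pos
  have hm : 0 < min δK δv := lt_min hδK hδv
  have hA : Decays (GcombSh (d := 3) Lc j) (|C|) (min δK δv) := decays_of_le hK (min_le_left δK δv)
  have hV' : VertexFamily (vertexOfK (GcombSh (d := 3) Lc j) Lc (JsB12CombSh0 hLc N tabs cΛ cB j).S) Lc (|Cv|) (min δK δv) :=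
    fun μ y => biLoc_of_le (hV μ y) (min_le_right δK δv)
  have hVcov : ∀ (μ : Fin (3 + 1)) (y s : Fin (3 + 1) → ℤ),
      vertexOfK (GcombSh (d := 3) Lc j) Lc (JsB12CombSh0 hLc N tabs cΛ cB j).S μ (y + s) =
        shiftK (-((Lc : ℤ) • s)) (vertexOfK (GcombSh (d := 3) Lc j) Lc (JsB12CombSh0 hLc N tabs cΛ cB j).S μ y) :=
    fun μ y s => vertexOfK_translate_block (fun s => shiftK_GcombSh (d := 3) Lc j s)
      (fun κ u s => JsB12CombSh0_S_translate hLc N tabs cΛ cB j κ u s) μ y s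
  exact hessKer_swap hA hm (fun s => shiftK_GcombSh (d := 3) Lc j s) hV' hVcov
    (fun μ y ν y' s => JsB12CombSh0_W_translate hLc N tabs cΛ cB j μ y ν y' s)
    (fun μ y ν y' => JsB12CombSh0_W_swap hLc N tabs cΛ cB j μ y ν y') a b t

/-- [folklore] **THE PRINTED PREDICATE (5.8) HOLDS FOR EVERY STEP KERNEL OF THE (III′) LITERAL** over every table record: `IndexSymmetric (TbalOf Lc (JsB12CombShSym …) j)`
(`PolarizationSign.IndexSymmetric` = the typed form of [Balaban1987RG1] (5.8) p. 293 — here a theorem about the b2b cell's own object). -/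
theorem indexSymmetric_TbalOf_JsB12CombShSym (hLc : Odd Lc) (N : ℕ) (tabs : SymTables 3 Lc) (cΛ cB : ℝ) (j : ℕ) :
    IndexSymmetric (TbalOf Lc (JsB12CombShSym hLc N tabs cΛ cB) j) :=
  fun μ ν x => TbalOf_JsB12CombShSym_swap hLc N tabs cΛ cB j μ ν x

/-- [folklore] The same for the flipped kernels of the printed-variable convention (R21) (the predicate is invariant under `z ↦ −z`). -/
theorem indexSymmetric_flipK_TbalOf_JsB12CombShSym (hLc : Odd Lc) (N : ℕ) (tabs : SymTables 3 Lc) (cΛ cB : ℝ) (j : ℕ) :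
    IndexSymmetric (flipK (TbalOf Lc (JsB12CombShSym hLc N tabs cΛ cB) j)) := by
  intro μ ν x
  simp only [OneStepKernelFamily.flipK_apply, neg_neg]
  have h := TbalOf_JsB12CombShSym_swap hLc N tabs cΛ cB j μ ν (-x)
  rwa [neg_neg] at h

/-! ## §3 Channel symmetry of the (1.22) coefficients and of the binder, every table record; the literal OF RECORD -/

/-- [folklore] **EVERY (1.22) COEFFICIENT OF THE (III′) LITERAL IS SYMMETRIC IN ITS CHANNEL**: `secondMoment (TbalOf Lc (JsB12CombShSym …) j) μ ν = secondMoment (…) ν μ`. -/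
theorem secondMoment_TbalOf_JsB12CombShSym_comm (hLc : Odd Lc) (N : ℕ) (tabs : SymTables 3 Lc) (cΛ cB : ℝ) (j : ℕ) (μ ν : Fin 4) :
    B12Beta.secondMoment (TbalOf Lc (JsB12CombShSym hLc N tabs cΛ cB) j) μ ν = B12Beta.secondMoment (TbalOf Lc (JsB12CombShSym hLc N tabs cΛ cB) j) ν μ :=
  secondMoment_comm (indexSymmetric_TbalOf_JsB12CombShSym hLc N tabs cΛ cB j) μ ν

/-- [folklore] The whole sequence of (1.22) coefficients is channel-symmetric (`funext`). -/
theorem secondMoment_TbalOf_JsB12CombShSym_comm_fun (hLc : Odd Lc) (N : ℕ) (tabs : SymTables 3 Lc) (cΛ cB : ℝ) (μ ν : Fin 4) :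
    (fun j => B12Beta.secondMoment (TbalOf Lc (JsB12CombShSym hLc N tabs cΛ cB) j) μ ν) =
      fun j => B12Beta.secondMoment (TbalOf Lc (JsB12CombShSym hLc N tabs cΛ cB) j) ν μ :=
  funext fun j => secondMoment_TbalOf_JsB12CombShSym_comm hLc N tabs cΛ cB j μ ν

/-- [folklore] **THE BINDER (D1) AT THE (III′) LITERAL DOES NOT DEPEND ON THE ORDER OF THE CHANNEL PAIR** (every table record, every numeral `Nc`):
`D1Drift Lc (JsB12CombShSym …) Nc μ ν ↔ D1Drift Lc (JsB12CombShSym …) Nc ν μ`. -/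
theorem d1Drift_JsB12CombShSym_comm (hLc : Odd Lc) (N : ℕ) (tabs : SymTables 3 Lc) (cΛ cB : ℝ) (Nc : ℝ) (μ ν : Fin 4) :
    D1Drift Lc (JsB12CombShSym hLc N tabs cΛ cB) Nc μ ν ↔ D1Drift Lc (JsB12CombShSym hLc N tabs cΛ cB) Nc ν μ := by
  unfold OneStepKernelFamily.D1Drift
  rw [secondMoment_TbalOf_JsB12CombShSym_comm_fun]

/-- [folklore] **AT THE LITERAL OF RECORD of `HOME/BALABAN-GAPS.md` row (D1)** — `JsB12CombShSym hLc N (symTablesAn1S2 3 Lc (2∕Lc⁴)) (2∕Lc⁴) (−Lc¹²∕4)` (an1's symmetrised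
table record, print's pins `cΛ = 2∕Lc⁴`, `cB = −Lc¹²∕4`): the binder is channel-order blind, `D1Drift … Nc μ ν ↔ D1Drift … Nc ν μ` — the wall's `(0,1)` and `(1,0)` are ONE statement. -/
theorem d1Drift_record_comm (hLc : Odd Lc) (N : ℕ) (Nc : ℝ) (μ ν : Fin 4) :
    D1Drift Lc (JsB12CombShSym hLc N (symTablesAn1S2 3 Lc (2 / (Lc : ℝ) ^ 4)) (2 / (Lc : ℝ) ^ 4) (-((Lc : ℝ) ^ 12 / 4))) Nc μ ν ↔
      D1Drift Lc (JsB12CombShSym hLc N (symTablesAn1S2 3 Lc (2 / (Lc : ℝ) ^ 4)) (2 / (Lc : ℝ) ^ 4) (-((Lc : ℝ) ^ 12 / 4))) Nc ν μ :=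
  d1Drift_JsB12CombShSym_comm hLc N _ _ _ Nc μ ν

/-! ## §4 Under the wall's Ward binder `hW` (the FIRST identity of (5.9)) the SECOND identity of (5.9) follows from (5.8) -/

/-- [folklore] **FOR THE (III′) LITERAL THE END's BINDER `hW` ALREADY GIVES BOTH IDENTITIES OF (5.9)** (every table record): if `flipK (TbalOf Lc (JsB12CombShSym …) j)` is
Ward-transversal in its first index (`PolarizationSign.WardTransversal`, the END `d1Drift_of_D1Tel_D1Rep`'s displayed `hW`), then `Σ_ν (P_{μν}(z + e_ν) − P_{μν}(z)) = 0` as well — the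
second identity «Σ_ν ∂_ν Π_{μν} = 0» of [Balaban1987RG1] (5.9) p. 293, which `Beta.KernelWard` leaves underived («it would follow … from index symmetry») — by §2's theorem (5.8)
(the generic transfer lemma is `Gaps/D1PinnedIndexSymmetry.ward_second_of_first_of_indexSymmetric`; inlined here to keep the two files independent). -/
theorem ward_second_flipK_TbalOf_JsB12CombShSym_of_hW (hLc : Odd Lc) (N : ℕ) (tabs : SymTables 3 Lc) (cΛ cB : ℝ) (j : ℕ)
    (hW : WardTransversal (flipK (TbalOf Lc (JsB12CombShSym hLc N tabs cΛ cB) j))) (μ : Fin 4) (z : Fin 4 → ℤ) :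
    ∑ ν, (flipK (TbalOf Lc (JsB12CombShSym hLc N tabs cΛ cB) j) μ ν (z + unitVec ν) - flipK (TbalOf Lc (JsB12CombShSym hLc N tabs cΛ cB) j) μ ν z) = 0 := by
  have hS := indexSymmetric_flipK_TbalOf_JsB12CombShSym hLc N tabs cΛ cB j
  have h := hW μ (-z)
  calc ∑ ν, (flipK (TbalOf Lc (JsB12CombShSym hLc N tabs cΛ cB) j) μ ν (z + unitVec ν) - flipK (TbalOf Lc (JsB12CombShSym hLc N tabs cΛ cB) j) μ ν z)
        = ∑ ν, (flipK (TbalOf Lc (JsB12CombShSym hLc N tabs cΛ cB) j) ν μ (-z - unitVec ν) - flipK (TbalOf Lc (JsB12CombShSym hLc N tabs cΛ cB) j) ν μ (-z)) := by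
        refine Finset.sum_congr rfl fun ν _ => ?_
        rw [hS μ ν (z + unitVec ν), hS μ ν z, neg_add']
    _ = 0 := h

/-! ## §5 The one-shot composite family of the record, `TshotOf Lc (JcOfTabs …) m`, is index-symmetric at every depth -/

/-- [folklore] **THE ONE-SHOT KERNEL AT DEPTH `m` IS THE ONE-STEP KERNEL AT LEVEL 0 OF THE (III′) LITERAL AT BLOCKING `Lc^m`** (any scale-indexed table record; no transport needed at
blocking `Lc^m`): `TshotOf Lc (JcOfTabs hLc N tabs cΛ cB) m = TbalOf (Lc^m) (JsB12CombShSym hLc.pow N (tabs m) (cΛ m) (cB m)) 0` (`KInvStep_zero_eq`, `vertexOfK_KInv` — as an2's `TshotOf_JcOfTabs_one`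
at `m = 1`). -/
theorem TshotOf_JcOfTabs_eq_TbalOf_zero (hLc : Odd Lc) (N : ℕ) (tabs : ∀ m : ℕ, SymTables 3 (Lc ^ m)) (cΛ cB : ℕ → ℝ) (m : ℕ) :
    TshotOf Lc (JcOfTabs hLc N tabs cΛ cB) m = TbalOf (Lc ^ m) (JsB12CombShSym (Lc := Lc ^ m) hLc.pow N (tabs m) (cΛ m) (cB m)) 0 := by
  show TOf (N := Lc ^ m) (JcOfTabs hLc N tabs cΛ cB m) = TstepOf (Lc ^ m) 0 _
  rw [JcOfTabs_apply]
  unfold TOf TstepOf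
  rw [KInvStep_zero_eq, show vertexOfK (OneStepResolventKernel.KInv (N := Lc ^ m)) (Lc ^ m) (JsB12CombShSym (Lc := Lc ^ m) hLc.pow N (tabs m) (cΛ m) (cB m) 0).S
    = OneStepResolventKernel.vertexOf (N := Lc ^ m) (JsB12CombShSym (Lc := Lc ^ m) hLc.pow N (tabs m) (cΛ m) (cB m) 0).S from
    funext fun μ => funext fun y => vertexOfK_KInv _ μ y]

/-- [folklore] **(5.8) FOR THE ONE-SHOT COMPOSITE FAMILY OF THE RECORD AT EVERY DEPTH** (any scale-indexed table record `tabs`, any lock numerals `cΛ cB : ℕ → ℝ`; no letter):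
`TshotOf Lc (JcOfTabs …) m a b t = TshotOf Lc (JcOfTabs …) m b a (−t)` — §2 at blocking `Lc^m`, level `0`. -/
theorem TshotOf_JcOfTabs_swap (hLc : Odd Lc) (N : ℕ) (tabs : ∀ m : ℕ, SymTables 3 (Lc ^ m)) (cΛ cB : ℕ → ℝ) (m : ℕ) (a b : Fin (3 + 1)) (t : Fin (3 + 1) → ℤ) :
    TshotOf Lc (JcOfTabs hLc N tabs cΛ cB) m a b t = TshotOf Lc (JcOfTabs hLc N tabs cΛ cB) m b a (-t) := by
  rw [TshotOf_JcOfTabs_eq_TbalOf_zero]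
  exact TbalOf_JsB12CombShSym_swap (Lc := Lc ^ m) hLc.pow N (tabs m) (cΛ m) (cB m) 0 a b t

/-- [folklore] `IndexSymmetric (TshotOf Lc (JcOfTabs …) m)` — the D1Tel ∕ D1Rep partner family of the record obeys (5.8) at every depth; in particular for an1's record
`JcOf hLc N cΛ cB = JcOfTabs hLc N (fun m ↦ symTablesAn1S2 3 (Lc^m) (cΛ m)) cΛ cB` (`JcOf_eq_JcOfTabs`, `rfl`). -/
theorem indexSymmetric_TshotOf_JcOfTabs (hLc : Odd Lc) (N : ℕ) (tabs : ∀ m : ℕ, SymTables 3 (Lc ^ m)) (cΛ cB : ℕ → ℝ) (m : ℕ) :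
    IndexSymmetric (TshotOf Lc (JcOfTabs hLc N tabs cΛ cB) m) :=
  fun μ ν x => TshotOf_JcOfTabs_swap hLc N tabs cΛ cB m μ ν x

/-- [folklore] The one-shot (1.22) read-outs of the record's composite family are channel-symmetric at every depth: `secondMoment (TshotOf Lc (JcOf …) m) μ ν = (same) ν μ`. -/
theorem secondMoment_TshotOf_JcOf_comm (hLc : Odd Lc) (N : ℕ) (cΛ cB : ℕ → ℝ) (m : ℕ) (μ ν : Fin 4) :
    B12Beta.secondMoment (TshotOf Lc (JcOf hLc N cΛ cB) m) μ ν = B12Beta.secondMoment (TshotOf Lc (JcOf hLc N cΛ cB) m) ν μ := by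
  rw [JcOf_eq_JcOfTabs]
  exact secondMoment_comm (indexSymmetric_TshotOf_JcOfTabs hLc N _ cΛ cB m) μ ν

/-! ## §6 The EXIT-A predicate `D1Rep` at the record is channel-order blind too (its comparison side is symmetric by inspection) -/

section OneShotSide

/-- [folklore] The forward mixed second difference is symmetric in its two steps. -/
theorem mixedDiffFun_comm {Λ : Type*} [AddCommGroup Λ] (g : Λ → ℝ) (e e' v : Λ) : mixedDiffFun g e e' v = mixedDiffFun g e' e v := by
  unfold mixedDiffFun
  rw [add_right_comm v e' e]
  ring

/-- [folklore] The cell form is symmetric in its two steps. -/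
theorem cellForm_comm {Λ : Type*} [AddCommGroup Λ] (g : Λ → ℝ) (e e' v : Λ) : cellForm g e e' v = cellForm g e' e v := by
  unfold cellForm
  rw [mixedDiffFun_comm]
  ring

/-- [folklore] The weighted stencil kernel of the one-shot side is symmetric in its channel (`SquareTable.stK_eq_closedForm` + the two symmetries above). -/
theorem stK_comm (μ ν : Fin 4) (N : ℝ) (G : DyadicShell.Pt → ℝ) (w : DyadicShell.Pt) : stK μ ν N G w = stK ν μ N G w := by
  rw [stK_eq_closedForm, stK_eq_closedForm, mixedDiffFun_comm, cellForm_comm]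
  ring

/-- [folklore] **THE ONE-SHOT SIDE OF `D1Rep` IS CHANNEL-SYMMETRIC**: `oneShotSide SL μ ν N a k n = oneShotSide SL ν μ N a k n` (the explicit `K^∞` legs `GfE a k n b` do not carry the channel). -/
theorem oneShotSide_comm {L : Type*} (SL : Finset L) (μ ν : Fin 4) (N a : ℝ) (k : L → Fin 4) (n : ℕ) :
    oneShotSide SL μ ν N a k n = oneShotSide SL ν μ N a k n := by
  unfold oneShotSide
  refine Finset.sum_congr rfl fun b _ => ?_
  rw [show stK μ ν N (VectorLegVolumeAdapter.GfE a k n b) = stK ν μ N (VectorLegVolumeAdapter.GfE a k n b) from funext fun w => stK_comm μ ν N _ w]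

end OneShotSide

/-- [folklore] **THE EXIT-A PREDICATE `D1Rep` OVER THE RECORD's ONE-SHOT COMPOSITE FAMILY DOES NOT SEE THE ORDER OF THE CHANNEL PAIR** (every scale-indexed table record, lock numerals, `N`, `a`,
label data): `D1Rep Lc (JcOfTabs …) Nc μ ν a SL k ↔ D1Rep Lc (JcOfTabs …) Nc ν μ a SL k` — §5 for the read-outs, `oneShotSide_comm` for the comparison side. -/
theorem d1Rep_JcOfTabs_comm {L : Type*} (hLc : Odd Lc) (N : ℕ) (tabs : ∀ m : ℕ, SymTables 3 (Lc ^ m)) (cΛ cB : ℕ → ℝ) (Nc : ℝ) (μ ν : Fin 4) (a : ℝ) (SL : Finset L)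
    (k : L → Fin 4) :
    D1Rep Lc (JcOfTabs hLc N tabs cΛ cB) Nc μ ν a SL k ↔ D1Rep Lc (JcOfTabs hLc N tabs cΛ cB) Nc ν μ a SL k := by
  unfold OneStepKernelFamily.D1Rep
  simp only [secondMoment_comm (indexSymmetric_TshotOf_JcOfTabs hLc N tabs cΛ cB _) μ ν, oneShotSide_comm SL μ ν]

/-- [folklore] **BOTH EXIT PREDICATES AND THE BINDER AT THE RECORD ARE CHANNEL-ORDER BLIND** — `D1Rep` for an1's record `JcOf` (`JcOf_eq_JcOfTabs`). -/
theorem d1Rep_JcOf_comm {L : Type*} (hLc : Odd Lc) (N : ℕ) (cΛ cB : ℕ → ℝ) (Nc : ℝ) (μ ν : Fin 4) (a : ℝ) (SL : Finset L) (k : L → Fin 4) :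
    D1Rep Lc (JcOf hLc N cΛ cB) Nc μ ν a SL k ↔ D1Rep Lc (JcOf hLc N cΛ cB) Nc ν μ a SL k := by
  rw [JcOf_eq_JcOfTabs]
  exact d1Rep_JcOfTabs_comm hLc N _ cΛ cB Nc μ ν a SL k

end Summit.QuantumFields.BalabanUV.Gaps.D1RecordIndexSymmetry

end
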